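import Summits.CriticalPhenomena.PercolationContinuityZ3.Theorems.PercNearOneGluingNoHeavyQuantHubProfilePairing
import HarnessLib

/-!
# QUANT lane R8 tool: the termwise bounds of the profile-conjecture assembly (census-1 PROFILE-PROOF-G10 §3 (E0)–(E3), (EK); §11 (B-0)–(B-4))
# and the Poisson-tail nonnegativity they imply by pairing

builds on p205010 (kernel theorem, internal audit signed; external expert review pending)

Support file (`--supports stmt-CriticalPhenomena-4575`), QUANT lane typer seat prim-quant-stmt (gen 15); steps S3/S4 of the assembly of
`Quant.HubBlocksProfileIneq`.  Pure real algebra; theorems only; no definitions, no sorries, standard axioms.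

ABSTRACT DATA (the only things the assembly uses about the blocks): `TW0 = P(s ≤ W)`, `TWs M = P(s ≤ M + W)` (so `TW0 ≤ TWs M ≤ 1`, `TWs` monotone),
least gate `g`, hub gate `G ∈ (0,1]`, RR parameter `μ > 0`, top `m`, `θ = min(Gμ/m, g)`, level in `ℓ`-units `τ* = θ/G`, test function
`ℓ b = TWs b + ((1−G)/G)·TW0` (`G·ℓ b = Λ(b) = G·P(s ≤ b + W) + (1−G)·P(s ≤ W)`).  The four blob-sum rows enter as HYPOTHESES on these numbers:
(H_M) `min(Gμ/M, g) ≤ (Gμ/M)·TWs M + (1 − Gμ/M)·TW0` (K4, `IndepBlob.hubMixture_far`), (F_i) `g ≤ TWs i` (block-star FAR), (HR_k) `g/2 ≤ TWs k`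
(`IndepBlob.halfRow`), (V_k) `min(Gμ/m, g) ≤ (1−G)TW0 + G((m−μ)/(m−k))TWs k + G((μ−k)/(m−k))TWs m` (`IndepBlob.twoPointHub_vertex`).

* CASE A terms (`e i = ℓ i − τ* − (i − μ)/m`): `termA_zero` (E0), `termA_high` (E1, `Gμ ≤ i ≤ μ`), `termA_mid` (E2: `e i ≥ (Gμ − i)/m` from (F_i)),
  `termA_neg` (E3: `e i ≥ −i/m`), `termA_unpaired` (EK from (HR_k), `2k < Gμ`).
* CASE B2 terms (`b* = m`, `E' i = (m−μ)(ℓ i − τ*) + (μ − i)(ℓ m − τ*)`): `termB_zero` (B-0), `termB_high` (B-1), `termB_mid` (B-2), `termB_pair` (B-3),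
  `termB_unpaired` (B-4).
* `Quant.poissonTail_nonneg_of_bounds` — the pairing `i ↦ ⌊Gμ⌋ − i` against the Poisson weights: termwise/pairwise bounds ⟹
  `0 ≤ Σ_{i=t}^{n} e i·μ^i/i!` (`n = ⌊μ⌋`).
[this work]
-/

noncomputable section

namespace Summit.CriticalPhenomena.PercolationContinuityZ3.Theorems

namespace Quant

open Finset

/-! ### Pairing against the Poisson weights -/

/-- **Poisson tail from termwise and pairwise bounds.**  Let `n = ⌊μ⌋`, `0 ≤ γ ≤ μ`, `ḡ = ⌊γ⌋`.  If `e 0 ≥ 0`; `e i ≥ 0` for `1 ≤ i ≤ n` with `2i ≥ γ`;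
`e i ≥ 0` for the unpaired index (`1 ≤ i`, `2i < γ`, `2i = ḡ`); and `e i + e (ḡ − i) ≥ 0` for the paired ones (`1 ≤ i`, `2i < γ`, `2i ≠ ḡ`); then
`0 ≤ Σ_{i=t}^{n} e i · μ^i/i!` for every `t`. [this work] -/
theorem poissonTail_nonneg_of_bounds (μ γ : ℝ) (n t : ℕ) (e : ℕ → ℝ) (hμ : 0 < μ) (hγ0 : 0 ≤ γ) (hγμ : γ ≤ μ) (hn : n = ⌊μ⌋₊)
    (h0 : 0 ≤ e 0)
    (hbig : ∀ i : ℕ, 1 ≤ i → i ≤ n → γ ≤ 2 * (i : ℝ) → 0 ≤ e i)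
    (hunp : ∀ i : ℕ, 1 ≤ i → i ≤ n → 2 * (i : ℝ) < γ → 2 * i = ⌊γ⌋₊ → 0 ≤ e i)
    (hpair : ∀ i : ℕ, 1 ≤ i → 2 * (i : ℝ) < γ → 2 * i ≠ ⌊γ⌋₊ → 0 ≤ e i + e (⌊γ⌋₊ - i)) :
    0 ≤ ∑ i ∈ Finset.Ico t (n + 1), e i * (μ ^ i / (Nat.factorial i : ℝ)) := by
  classical
  have hnμ : (n : ℝ) ≤ μ := by rw [hn]; exact Nat.floor_le hμ.le
  have hgn : ⌊γ⌋₊ ≤ n := by rw [hn]; exact Nat.floor_mono hγμ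
  have hgγ : (⌊γ⌋₊ : ℝ) ≤ γ := Nat.floor_le hγ0
  have hγg : γ < (⌊γ⌋₊ : ℝ) + 1 := Nat.lt_floor_add_one γ
  set S : Finset ℕ := Finset.Ico t (n + 1) with hS
  set N : Finset ℕ := S.filter (fun i : ℕ => 1 ≤ i ∧ 2 * (i : ℝ) < γ ∧ 2 * i ≠ ⌊γ⌋₊) with hN
  refine sum_nonneg_of_pairing (fun i => e i * (μ ^ i / (Nat.factorial i : ℝ))) S N (fun i => ⌊γ⌋₊ - i)
    (Finset.filter_subset _ _) ?_ ?_ ?_ ?_ ?_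
  · -- partners stay in the range
    intro i hi
    obtain ⟨hiS, hi1, hiγ, hne⟩ := Finset.mem_filter.1 hi
    rw [hS, Finset.mem_Ico] at hiS ⊢
    have h2i : 2 * i < ⌊γ⌋₊ := by
      have : 2 * i ≤ ⌊γ⌋₊ := Nat.le_floor (by push_cast; linarith)
      omega
    constructor <;> omega
  · -- partners are not negative candidates
    intro i hi
    obtain ⟨hiS, hi1, hiγ, hne⟩ := Finset.mem_filter.1 hi
    have h2i : 2 * i < ⌊γ⌋₊ := by
      have : 2 * i ≤ ⌊γ⌋₊ := Nat.le_floor (by push_cast; linarith)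
      omega
    rw [hN, Finset.mem_filter]
    rintro ⟨_, _, hlt, _⟩
    have : ((⌊γ⌋₊ - i : ℕ) : ℝ) = (⌊γ⌋₊ : ℝ) - i := by push_cast [Nat.cast_sub (by omega : i ≤ ⌊γ⌋₊)]; ring
    rw [this] at hlt
    have : (2 * i : ℝ) + 1 ≤ ⌊γ⌋₊ := by exact_mod_cast h2i
    linarith
  · -- injective
    intro i hi i' hi' h
    obtain ⟨_, _, hiγ, _⟩ := Finset.mem_filter.1 hi
    obtain ⟨_, _, hi'γ, _⟩ := Finset.mem_filter.1 hi'
    have h1 : 2 * i ≤ ⌊γ⌋₊ := Nat.le_floor (by push_cast; linarith)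
    have h2 : 2 * i' ≤ ⌊γ⌋₊ := Nat.le_floor (by push_cast; linarith)
    have h' : ⌊γ⌋₊ - i = ⌊γ⌋₊ - i' := h
    omega
  · -- pairs
    intro i hi
    obtain ⟨hiS, hi1, hiγ, hne⟩ := Finset.mem_filter.1 hi
    have h2i : 2 * i < ⌊γ⌋₊ := by
      have : 2 * i ≤ ⌊γ⌋₊ := Nat.le_floor (by push_cast; linarith)
      omega
    have hle : i ≤ ⌊γ⌋₊ - i := by omega
    have hi'n : ⌊γ⌋₊ - i ≤ n := by omega
    have hcast : ((⌊γ⌋₊ - i : ℕ) : ℝ) = (⌊γ⌋₊ : ℝ) - i := by push_cast [Nat.cast_sub (by omega : i ≤ ⌊γ⌋₊)]; ring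
    have hbig' : 0 ≤ e (⌊γ⌋₊ - i) := hbig _ (by omega) hi'n (by
      rw [hcast]; have : (2 * i : ℝ) + 1 ≤ ⌊γ⌋₊ := by exact_mod_cast h2i
      linarith)
    have hi'μ : ((⌊γ⌋₊ - i : ℕ) : ℝ) ≤ μ := by
      have : ((⌊γ⌋₊ - i : ℕ) : ℝ) ≤ n := by exact_mod_cast hi'n
      linarith
    have hw : μ ^ i / (Nat.factorial i : ℝ) ≤ μ ^ (⌊γ⌋₊ - i) / (Nat.factorial (⌊γ⌋₊ - i) : ℝ) :=
      poissonWeight_mono hμ hle hi'μ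
    have := pair_weighted_nonneg hbig' (hpair i hi1 hiγ hne) (poissonWeight_pos hμ i).le hw
    simpa [mul_comm] using this
  · -- all other terms are nonnegative
    intro i hiS hiN
    rw [hS, Finset.mem_Ico] at hiS
    have hin : i ≤ n := by omega
    refine mul_nonneg ?_ (poissonWeight_pos hμ i).le
    rcases Nat.eq_zero_or_pos i with rfl | hi1
    · exact h0
    · by_cases hγi : γ ≤ 2 * (i : ℝ)
      · exact hbig i hi1 hin hγi
      · push Not at hγi
        have heq : 2 * i = ⌊γ⌋₊ := by
          by_contra hne
          exact hiN (Finset.mem_filter.2 ⟨by rw [hS, Finset.mem_Ico]; exact hiS, hi1, hγi, hne⟩)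
        exact hunp i hi1 hin hγi heq


/-! ### Termwise bounds — CASE A (`ν = 1/m`: `e i = ℓ i − θ/G − (i − μ)/m`, `ℓ b = TWs b + ((1−G)/G)·TW0`, `θ = min(Gμ/m, g)`) -/

section Terms

variable {μ G g θ TW0 mR : ℝ}

/-- `θ/G ≤ μ/m`. [this work] -/
theorem theta_div_le (hG0 : 0 < G) (hm0 : 0 < mR) (hθm : θ ≤ G * μ / mR) : θ / G ≤ μ / mR := by
  rw [div_le_div_iff₀ hG0 hm0]
  have := (le_div_iff₀ hm0).1 hθm
  linarith

/-- (E0) `e 0 ≥ 0`. [this work] -/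
theorem termA_zero (hG0 : 0 < G) (hm0 : 0 < mR) (hθm : θ ≤ G * μ / mR) {ℓ0 : ℝ} (hℓ0 : 0 ≤ ℓ0) :
    0 ≤ ℓ0 - θ / G - (((0 : ℕ) : ℝ) - μ) / mR := by
  have h := theta_div_le hG0 hm0 hθm
  have : (((0 : ℕ) : ℝ) - μ) / mR = -(μ / mR) := by push_cast; ring
  rw [this]; linarith

/-- (E3) `e i ≥ −i/m`. [this work] -/
theorem termA_neg (hG0 : 0 < G) (hm0 : 0 < mR) (hθm : θ ≤ G * μ / mR) (i : ℝ) {ℓi : ℝ} (hℓ : 0 ≤ ℓi) :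
    -i / mR ≤ ℓi - θ / G - (i - μ) / mR := by
  have h := theta_div_le hG0 hm0 hθm
  have : (i - μ) / mR = i / mR - μ / mR := by ring
  rw [this, neg_div]; linarith

/-- (E2) a block-star FAR row `g ≤ TWs i` gives `e i ≥ (Gμ − i)/m`. [this work] -/
theorem termA_mid (hG0 : 0 < G) (hG1 : G ≤ 1) (hm0 : 0 < mR) (hTW0 : 0 ≤ TW0) (hθ : θ = min (G * μ / mR) g) (i : ℝ) {TWi : ℝ}
    (hF : g ≤ TWi) :
    (G * μ - i) / mR ≤ TWi + (1 - G) / G * TW0 - θ / G - (i - μ) / mR := by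
  have hc : 0 ≤ (1 - G) / G * TW0 := mul_nonneg (div_nonneg (by linarith) hG0.le) hTW0
  rcases le_total (G * μ / mR) g with h | h
  · rw [min_eq_left h] at hθ
    have e1 : θ / G = μ / mR := by rw [hθ]; field_simp
    rw [e1]
    have : (G * μ - i) / mR = G * μ / mR - i / mR := by ring
    have : (i - μ) / mR = i / mR - μ / mR := by ring
    nlinarith
  · rw [min_eq_right h] at hθ
    subst hθ
    -- `(1 − G)(μ/m − g/G) ≥ 0`
    have hgG : θ / G ≤ μ / mR := by
      rw [div_le_div_iff₀ hG0 hm0]; have := (le_div_iff₀ hm0).1 h; linarith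
    have key : (G * μ - i) / mR = (TWi - θ / G - (i - μ) / mR) - (TWi - θ) - (1 - G) * (μ / mR - θ / G) := by
      field_simp; ring
    rw [key]
    nlinarith [mul_nonneg (by linarith : 0 ≤ 1 - G) (sub_nonneg.2 hgG)]

/-- (E1) a K4 row at `(i, Gμ/i)` with `Gμ ≤ i ≤ μ` gives `e i ≥ 0`. [this work] -/
theorem termA_high (hG0 : 0 < G) (hμ : 0 < μ) (hm0 : 0 < mR) (hμm : μ ≤ mR) (hTW0 : 0 ≤ TW0)
    (hθ : θ = min (G * μ / mR) g) (i : ℝ) {TWi : ℝ} (hi0 : 0 < i) (hiμ : i ≤ μ)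
    (hH : min (G * μ / i) g ≤ G * μ / i * TWi + (1 - G * μ / i) * TW0) :
    0 ≤ TWi + (1 - G) / G * TW0 - θ / G - (i - μ) / mR := by
  -- `Λ := G·TWi + (1−G)·TW0 ≥ (i/μ)·min(Gμ/i, g)`
  have hΛ : i / μ * min (G * μ / i) g ≤ G * TWi + (1 - G) * TW0 := by
    have h1 : min (G * μ / i) g - TW0 ≤ G * μ / i * (TWi - TW0) := by linarith
    have h2 : i / μ * (min (G * μ / i) g - TW0) ≤ i / μ * (G * μ / i * (TWi - TW0)) :=
      mul_le_mul_of_nonneg_left h1 (div_nonneg hi0.le hμ.le)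
    have h3 : i / μ * (G * μ / i * (TWi - TW0)) = G * (TWi - TW0) := by field_simp
    have h4 : 0 ≤ (1 - i / μ) * TW0 := mul_nonneg (by rw [sub_nonneg, div_le_one hμ]; exact hiμ) hTW0
    nlinarith
  -- target times `G`
  have hgoal : θ + G * (i - μ) / mR ≤ G * TWi + (1 - G) * TW0 := by
    rcases le_total (G * μ / i) g with h | h
    · rw [min_eq_left h] at hΛ
      have : i / μ * (G * μ / i) = G := by field_simp
      rw [this] at hΛ
      have hθm : θ ≤ G * μ / mR := by rw [hθ]; exact min_le_left _ _
      have : θ + G * (i - μ) / mR ≤ G * i / mR := by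
        have e : G * i / mR = G * μ / mR + G * (i - μ) / mR := by ring
        linarith
      have : G * i / mR ≤ G := by
        rw [div_le_iff₀ hm0]; nlinarith
      linarith
    · rw [min_eq_right h] at hΛ
      rcases le_total (G * μ / mR) g with h' | h'
      · rw [min_eq_left h'] at hθ
        -- `g·i/μ ≥ (Gμ/m)(i/μ) = G i/m = θ + G(i−μ)/m`
        have : θ + G * (i - μ) / mR = G * i / mR := by rw [hθ]; ring
        rw [this]
        have : G * i / mR = i / μ * (G * μ / mR) := by field_simp
        rw [this]
        exact le_trans (mul_le_mul_of_nonneg_left h' (div_nonneg hi0.le hμ.le)) hΛ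
      · rw [min_eq_right h'] at hθ
        subst hθ
        -- `g i/μ − g − G(i−μ)/m = (μ − i)(G/m − g/μ) ≥ 0`
        have hgm : θ / μ ≤ G / mR := by
          rw [div_le_div_iff₀ hμ hm0]; have := (le_div_iff₀ hm0).1 h'; linarith
        have key : i / μ * θ - (θ + G * (i - μ) / mR) = (μ - i) * (G / mR - θ / μ) := by
          field_simp; ring
        nlinarith [mul_nonneg (sub_nonneg.2 hiμ) (sub_nonneg.2 hgm)]
  have e : TWi + (1 - G) / G * TW0 - θ / G - (i - μ) / mR = (G * TWi + (1 - G) * TW0 - (θ + G * (i - μ) / mR)) / G := by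
    field_simp; ring
  rw [e]
  exact div_nonneg (by linarith) hG0.le

/-- (EK) a half-row `g/2 ≤ TWs k` with `2k < Gμ` gives `e k ≥ 0`. [this work] -/
theorem termA_unpaired (hG0 : 0 < G) (hG1 : G ≤ 1) (hm0 : 0 < mR) (hTW0 : 0 ≤ TW0) (hθ : θ = min (G * μ / mR) g)
    (k : ℝ) {TWk : ℝ} (h2k : 2 * k < G * μ) (hHR : g / 2 ≤ TWk) :
    0 ≤ TWk + (1 - G) / G * TW0 - θ / G - (k - μ) / mR := by
  have hc : 0 ≤ (1 - G) / G * TW0 := mul_nonneg (div_nonneg (by linarith) hG0.le) hTW0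
  rcases le_total (G * μ / mR) g with h | h
  · rw [min_eq_left h] at hθ
    have e1 : θ / G = μ / mR := by rw [hθ]; field_simp
    rw [e1]
    have : g / 2 ≥ G * μ / (2 * mR) := by
      have : G * μ / (2 * mR) = (G * μ / mR) / 2 := by field_simp
      linarith
    have e2 : G * μ / (2 * mR) - μ / mR - (k - μ) / mR = (G * μ - 2 * k) / (2 * mR) := by field_simp; ring
    have : 0 < (G * μ - 2 * k) / (2 * mR) := div_pos (by linarith) (by linarith)
    nlinarith
  · rw [min_eq_right h] at hθ
    subst hθ
    -- `θ(1/G − 1/2) ≤ (Gμ/m)(1/G − 1/2) = μ/m − Gμ/(2m)`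
    have hcoef : 0 ≤ 1 / G - 1 / 2 := by
      have := one_div_le_one_div_of_le hG0 (show G ≤ 2 by linarith); linarith
    have h1 : θ * (1 / G - 1 / 2) ≤ G * μ / mR * (1 / G - 1 / 2) := mul_le_mul_of_nonneg_right h hcoef
    have e1 : G * μ / mR * (1 / G - 1 / 2) = μ / mR - G * μ / (2 * mR) := by field_simp
    have e2 : TWk + (1 - G) / G * TW0 - θ / G - (k - μ) / mR =
        (TWk - θ / 2) + (1 - G) / G * TW0 - θ * (1 / G - 1 / 2) + (μ - k) / mR := by field_simp; ring
    rw [e2]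
    have e3 : (μ - k) / mR - (μ / mR - G * μ / (2 * mR)) = (G * μ - 2 * k) / (2 * mR) := by field_simp; ring
    have : 0 < (G * μ - 2 * k) / (2 * mR) := div_pos (by linarith) (by linarith)
    nlinarith

/-! ### Termwise bounds — CASE B2 (`b* = m < s`, `μ < m`; `E' i = (m−μ)(ℓ i − θ/G) + (μ − i)(ℓ m − θ/G)`) -/

/-- From a K4 row at `(M, Gμ/M)`: `G·(TWs M − TW0) ≥ (M/μ)·(min(Gμ/M, g) − TW0)`. [this work] -/
theorem k4_gain (hμ : 0 < μ) (M : ℝ) (hM0 : 0 < M) {TWM : ℝ}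
    (hH : min (G * μ / M) g ≤ G * μ / M * TWM + (1 - G * μ / M) * TW0) :
    M / μ * (min (G * μ / M) g - TW0) ≤ G * (TWM - TW0) := by
  have h1 : min (G * μ / M) g - TW0 ≤ G * μ / M * (TWM - TW0) := by linarith
  have h2 := mul_le_mul_of_nonneg_left h1 (div_nonneg hM0.le hμ.le)
  have h3 : M / μ * (G * μ / M * (TWM - TW0)) = G * (TWM - TW0) := by field_simp
  linarith

/-- (B-0) `E' 0 ≥ 0` from the K4 row at `(m, Gμ/m)`. [this work] -/
theorem termB_zero (hG0 : 0 < G) (hμ : 0 < μ) (hm0 : 0 < mR) (hθ : θ = min (G * μ / mR) g) {TWm : ℝ}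
    (hH : min (G * μ / mR) g ≤ G * μ / mR * TWm + (1 - G * μ / mR) * TW0) :
    0 ≤ (mR - μ) * (TW0 + (1 - G) / G * TW0 - θ / G) + (μ - ((0 : ℕ) : ℝ)) * (TWm + (1 - G) / G * TW0 - θ / G) := by
  have hgain := k4_gain (G := G) (g := g) (TW0 := TW0) hμ mR hm0 hH
  rw [← hθ] at hgain
  -- `G·E'0 = m·[(1 − Gμ/m)TW0 + (Gμ/m)TWm − θ] = m·[TW0 − θ] + μ·G(TWm − TW0)`
  have e : (mR - μ) * (TW0 + (1 - G) / G * TW0 - θ / G) + (μ - ((0 : ℕ) : ℝ)) * (TWm + (1 - G) / G * TW0 - θ / G) =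
      (mR * (TW0 - θ) + μ * (G * (TWm - TW0))) / G := by
    push_cast; field_simp; ring
  rw [e]
  refine div_nonneg ?_ hG0.le
  have : mR * (TW0 - θ) + μ * (mR / μ * (θ - TW0)) = 0 := by field_simp; ring
  nlinarith [mul_le_mul_of_nonneg_left hgain hμ.le]

/-- (B-1) `E' i ≥ 0` for `Gμ ≤ i ≤ μ` from the K4 rows at `(i, Gμ/i)` and `(m, Gμ/m)`. [this work] -/
theorem termB_high (hG0 : 0 < G) (hμ : 0 < μ) (hm0 : 0 < mR) (hμm : μ ≤ mR) (hθ : θ = min (G * μ / mR) g)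
    (i : ℝ) {TWi TWm : ℝ} (hi0 : 0 < i) (hiμ : i ≤ μ)
    (hHi : min (G * μ / i) g ≤ G * μ / i * TWi + (1 - G * μ / i) * TW0)
    (hHm : min (G * μ / mR) g ≤ G * μ / mR * TWm + (1 - G * μ / mR) * TW0) :
    0 ≤ (mR - μ) * (TWi + (1 - G) / G * TW0 - θ / G) + (μ - i) * (TWm + (1 - G) / G * TW0 - θ / G) := by
  have hgi := k4_gain (G := G) (g := g) (TW0 := TW0) hμ i hi0 hHi
  have hgm := k4_gain (G := G) (g := g) (TW0 := TW0) hμ mR hm0 hHm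
  rw [← hθ] at hgm
  -- `min(Gμ/i, g) ≥ min(Gμ/m, g) = θ` since `i ≤ m`
  have hmin : θ ≤ min (G * μ / i) g := by
    rw [hθ]
    exact min_le_min (div_le_div_of_nonneg_left (by nlinarith) hi0 (hiμ.trans hμm)) le_rfl
  have hgi' : i / μ * (θ - TW0) ≤ G * (TWi - TW0) :=
    le_trans (mul_le_mul_of_nonneg_left (by linarith) (div_nonneg hi0.le hμ.le)) hgi
  have e : (mR - μ) * (TWi + (1 - G) / G * TW0 - θ / G) + (μ - i) * (TWm + (1 - G) / G * TW0 - θ / G) =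
      ((mR - μ) * ((TW0 - θ) + G * (TWi - TW0)) + (μ - i) * ((TW0 - θ) + G * (TWm - TW0))) / G := by
    field_simp; ring
  rw [e]
  refine div_nonneg ?_ hG0.le
  have hz : (mR - μ) * ((TW0 - θ) + i / μ * (θ - TW0)) + (μ - i) * ((TW0 - θ) + mR / μ * (θ - TW0)) = 0 := by
    field_simp; ring
  nlinarith [mul_le_mul_of_nonneg_left hgi' (sub_nonneg.2 hμm), mul_le_mul_of_nonneg_left hgm (sub_nonneg.2 hiμ)]

/-- (B-2) `E' i ≥ 0` for `i ≤ Gμ` from a block-star FAR row `g ≤ TWs i` and the K4 row at `(m, Gμ/m)`. [this work] -/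
theorem termB_mid (hG0 : 0 < G) (hG1 : G ≤ 1) (hμ : 0 < μ) (hm0 : 0 < mR) (hμm : μ ≤ mR) (hθ : θ = min (G * μ / mR) g)
    (i : ℝ) {TWi TWm : ℝ} (hi0 : 0 ≤ i) (hiG : i ≤ G * μ) (hTWi : TW0 ≤ TWi) (hF : g ≤ TWi)
    (hHm : min (G * μ / mR) g ≤ G * μ / mR * TWm + (1 - G * μ / mR) * TW0) :
    0 ≤ (mR - μ) * (TWi + (1 - G) / G * TW0 - θ / G) + (μ - i) * (TWm + (1 - G) / G * TW0 - θ / G) := by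
  have hgm := k4_gain (G := G) (g := g) (TW0 := TW0) hμ mR hm0 hHm
  rw [← hθ] at hgm
  have hθg : θ ≤ g := by rw [hθ]; exact min_le_right _ _
  have hiμ : i ≤ μ := hiG.trans (by nlinarith)
  -- `G·(TWi − TW0) ≥ (i/μ)(TWi − TW0) ≥ (i/μ)(θ − TW0)`
  have hgi' : i / μ * (θ - TW0) ≤ G * (TWi - TW0) := by
    have h1 : i / μ ≤ G := by rw [div_le_iff₀ hμ]; linarith
    have h2 : i / μ * (TWi - TW0) ≤ G * (TWi - TW0) := mul_le_mul_of_nonneg_right h1 (sub_nonneg.2 hTWi)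
    have h3 : i / μ * (θ - TW0) ≤ i / μ * (TWi - TW0) := mul_le_mul_of_nonneg_left (by linarith) (div_nonneg hi0 hμ.le)
    linarith
  have e : (mR - μ) * (TWi + (1 - G) / G * TW0 - θ / G) + (μ - i) * (TWm + (1 - G) / G * TW0 - θ / G) =
      ((mR - μ) * ((TW0 - θ) + G * (TWi - TW0)) + (μ - i) * ((TW0 - θ) + G * (TWm - TW0))) / G := by
    field_simp; ring
  rw [e]
  refine div_nonneg ?_ hG0.le
  have hz : (mR - μ) * ((TW0 - θ) + i / μ * (θ - TW0)) + (μ - i) * ((TW0 - θ) + mR / μ * (θ - TW0)) = 0 := by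
    field_simp; ring
  nlinarith [mul_le_mul_of_nonneg_left hgi' (sub_nonneg.2 hμm), mul_le_mul_of_nonneg_left hgm (sub_nonneg.2 hiμ)]

/-- (B-3) the pair `E' i + E' i' ≥ 0` for `i + i' ≤ Gμ`, from `TW0 ≤ TWs i`, a block-star FAR row `g ≤ TWs i'` and the K4 row at `(m, Gμ/m)`.
[this work] -/
theorem termB_pair (hG0 : 0 < G) (hμ : 0 < μ) (hm0 : 0 < mR) (hμm : μ ≤ mR) (hθ : θ = min (G * μ / mR) g)
    (i i' : ℝ) {TWi TWi' TWm : ℝ} (hii' : i + i' ≤ G * μ) (hG1 : G ≤ 1) (hTWi : TW0 ≤ TWi)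
    (hTWi' : TW0 ≤ TWi') (hTWm : TW0 ≤ TWm) (hF : g ≤ TWi')
    (hHm : min (G * μ / mR) g ≤ G * μ / mR * TWm + (1 - G * μ / mR) * TW0) :
    0 ≤ ((mR - μ) * (TWi + (1 - G) / G * TW0 - θ / G) + (μ - i) * (TWm + (1 - G) / G * TW0 - θ / G)) +
      ((mR - μ) * (TWi' + (1 - G) / G * TW0 - θ / G) + (μ - i') * (TWm + (1 - G) / G * TW0 - θ / G)) := by
  have hgm := k4_gain (G := G) (g := g) (TW0 := TW0) hμ mR hm0 hHm
  rw [← hθ] at hgm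
  have hθg : θ ≤ g := by rw [hθ]; exact min_le_right _ _
  have hGμ : G * μ ≤ μ := by nlinarith
  have hsum : i + i' ≤ μ := hii'.trans hGμ
  have e : ((mR - μ) * (TWi + (1 - G) / G * TW0 - θ / G) + (μ - i) * (TWm + (1 - G) / G * TW0 - θ / G)) +
      ((mR - μ) * (TWi' + (1 - G) / G * TW0 - θ / G) + (μ - i') * (TWm + (1 - G) / G * TW0 - θ / G)) =
      ((2 * mR - i - i') * (TW0 - θ) + (mR - μ) * (G * (TWi - TW0)) + (mR - μ) * (G * (TWi' - TW0)) +
        (2 * μ - i - i') * (G * (TWm - TW0))) / G := by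
    field_simp; ring
  rw [e]
  refine div_nonneg ?_ hG0.le
  have hPi : 0 ≤ G * (TWi - TW0) := mul_nonneg hG0.le (sub_nonneg.2 hTWi)
  have hPm : 0 ≤ G * (TWm - TW0) := mul_nonneg hG0.le (sub_nonneg.2 hTWm)
  rcases le_or_gt θ TW0 with hD | hD
  · -- `TW0 ≥ θ`: every term is nonnegative
    have hPi' : 0 ≤ G * (TWi' - TW0) := mul_nonneg hG0.le (sub_nonneg.2 hTWi')
    have h1 : 0 ≤ (2 * mR - i - i') * (TW0 - θ) := mul_nonneg (by linarith) (by linarith)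
    nlinarith [mul_nonneg (sub_nonneg.2 hμm) hPi, mul_nonneg (sub_nonneg.2 hμm) hPi', mul_nonneg (by linarith : 0 ≤ 2 * μ - i - i') hPm]
  · -- `θ > TW0`: `G(TWi' − TW0) ≥ G(θ − TW0)`, `G(TWm − TW0) ≥ (m/μ)(θ − TW0)`, and the coefficients combine to `(m−μ)(G − (i+i')/μ)(θ − TW0) ≥ 0`
    have hPi' : G * (θ - TW0) ≤ G * (TWi' - TW0) := mul_le_mul_of_nonneg_left (by linarith) hG0.le
    have hcoef : 0 ≤ (mR - μ) * (G - (i + i') / μ) :=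
      mul_nonneg (sub_nonneg.2 hμm) (by rw [sub_nonneg, div_le_iff₀ hμ]; linarith)
    have hz : -(2 * mR - i - i') * (θ - TW0) + (mR - μ) * (G * (θ - TW0)) + (2 * μ - i - i') * (mR / μ * (θ - TW0)) =
        (mR - μ) * (G - (i + i') / μ) * (θ - TW0) := by
      field_simp; ring
    nlinarith [mul_le_mul_of_nonneg_left hPi' (sub_nonneg.2 hμm), mul_le_mul_of_nonneg_left hgm (by linarith : 0 ≤ 2 * μ - i - i'),
      mul_nonneg hcoef (sub_nonneg.2 hD.le), mul_nonneg (sub_nonneg.2 hμm) hPi]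

/-- (B-4) the unpaired term `E' k ≥ 0` is the vertex row `(V_k)` of `IndepBlob.twoPointHub_vertex`. [this work] -/
theorem termB_unpaired (hG0 : 0 < G) (k : ℝ) {TWk TWm : ℝ} (hkm : k < mR)
    (hV : θ ≤ (1 - G) * TW0 + G * ((mR - μ) / (mR - k)) * TWk + G * ((μ - k) / (mR - k)) * TWm) :
    0 ≤ (mR - μ) * (TWk + (1 - G) / G * TW0 - θ / G) + (μ - k) * (TWm + (1 - G) / G * TW0 - θ / G) := by
  have hmk : 0 < mR - k := by linarith
  have e : (mR - μ) * (TWk + (1 - G) / G * TW0 - θ / G) + (μ - k) * (TWm + (1 - G) / G * TW0 - θ / G) =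
      (mR - k) / G * ((1 - G) * TW0 + G * ((mR - μ) / (mR - k)) * TWk + G * ((μ - k) / (mR - k)) * TWm - θ) := by
    field_simp; ring
  rw [e]
  exact mul_nonneg (div_nonneg hmk.le hG0.le) (by linarith)

end Terms

end Quant

end Summit.CriticalPhenomena.PercolationContinuityZ3.Theorems

end
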